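import Literature.Combinatorics.StablePolynomials.DiskInversion
import Literature.Combinatorics.StablePolynomials.SymmetrizationDisk
import Literature.Combinatorics.StablePolynomials.SymmetryIndex
import HarnessLib

/-!
# Symmetrization for the exterior of a disc (Borcea–Brändén II, Theorem 1.2 (b) and Proposition 1.3 (b),
# `C = ℂ ∖ 𝔻̄`)

J. Borcea, P. Brändén, *The Lee–Yang and Pólya–Schur programs. II. Theory of stable polynomials and
applications*, Comm. Pure Appl. Math. 62 (2009) 1595–1631 (arXiv:0809.3087), §1:

> **Theorem 1.2.** Let `C` be an open or closed circular domain. […] (b) If `C` is non-convex and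
> `f ∈ ℂ_{(1ⁿ)}[z_1,…,z_n]` is `C`-stable and such that all variables are active in `f` (i.e.,
> `∂f/∂z_i ≠ 0`, `i ∈ [n]`) then `Sym(f)` is `C`-stable.
>
> **Proposition 1.3.** Let `f ∈ ℂ_{(1ⁿ)}[z_1,…,z_n]`, `C` be an open or closed circular domain, `0 ≤ p ≤ 1`,
> and `τ = (ij) ∈ 𝔖_n` be a transposition. […] (b) If `C` is non-convex and `f` is `C`-stable and
> depending on both `z_i` and `z_j` then `pf + (1-p)τ(f)` is also `C`-stable.
>
> *Proof of Theorem 1.2 / Proposition 1.3 (after Lemma 1.8).* "the partial symmetrization operator commutes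
> with `Φ_κ` … Hence by Lemma 1.8 it suffices to prove [them] for `H`."

For the non-convex model domain `C = ℂ ∖ 𝔻̄` (the exterior of the closed unit disc) the transport `Φ_κ`,
`κ = (1ⁿ)` resp. `κ = degVec f`, is the inversion `I_κ : z^α ↦ z^{κ-α}` of Corollary 1.7 (the tree's
`DiskInversion.lean`, resting on part I's Lemma 6.1): `I_κ` is linear, commutes with the permutations of the
variables fixing `κ` (`invOp_rename`, `symmetrization_invOp`), carries the `(ℂ ∖ 𝔻̄)`-stable polynomials of
degree `κ` to `𝔻`-stable ones (`invOp_diskStable`) and the `𝔻`-stable polynomials of `ℂ_κ[z]` back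
(`invOp_exteriorDiskStable`, `invOp_invOp`); the statements for `C = 𝔻` are the tree's
`IsDiskStable.symmetrization` and `IsDiskStable.partialSymmetrization` (`SymmetrizationDisk.lean`). The
activity hypotheses ("all variables active", "depending on both `z_i` and `z_j`") are exactly what makes
`κ = degVec f` invariant under the permutations used, i.e. what makes `f` "of degree `κ`" in Corollary 1.7.

-- TODO(general form): other non-convex circular domains (exteriors `{|z - c| > r}` by the affine change of
-- variables, and the closed exteriors `ℂ ∖ D`), loc. cit. Thm. 1.2 (b), Prop. 1.3 (b).

## Main results (namespace `Literature.Combinatorics.StablePolynomials`)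

* `invOp_eq_sum_of_subset`, `invOp_add`, `invOp_smul`, `invOp_sum`, `invOp_rename`, `symmetrization_invOp`.
* **`symmetrization_exteriorDiskStable`** — Theorem 1.2 (b) for `C = ℂ ∖ 𝔻̄`.
* **`partialSymmetrization_exteriorDiskStable`** — Proposition 1.3 (b) for `C = ℂ ∖ 𝔻̄`.

## References

* [BorceaBranden2009II] J. Borcea, P. Brändén, Comm. Pure Appl. Math. 62 (2009) 1595–1631, §1 Thm. 1.2 (b),
  Prop. 1.3 (b), Cor. 1.7, Lemma 1.8.
-/

noncomputable section

open MvPolynomial Finset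

namespace Literature.Combinatorics.StablePolynomials

variable {σ : Type*} [Fintype σ] [DecidableEq σ]

/-! ## §1 Linearity of `I_κ` and commutation with permutations of the variables -/

section Linear

omit [Fintype σ] [DecidableEq σ] in
/-- `I_κ(p)` may be computed over any finite set of exponents containing the support.
[cite: BorceaBranden2009II, §1 Cor. 1.7 (linearity of `I_κ`)] -/
theorem invOp_eq_sum_of_subset (κ : σ →₀ ℕ) {p : MvPolynomial σ ℂ} {S : Finset (σ →₀ ℕ)}
    (hS : p.support ⊆ S) : invOp κ p = ∑ α ∈ S, monomial (κ - α) (coeff α p) := by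
  rw [invOp]
  exact Finset.sum_subset hS fun α _ hα => by rw [notMem_support_iff.1 hα, monomial_zero]

omit [Fintype σ] in
/-- `I_κ` is additive. [cite: BorceaBranden2009II, §1 Cor. 1.7 ("the linear operator `I_κ`")] -/
theorem invOp_add (κ : σ →₀ ℕ) (p q : MvPolynomial σ ℂ) : invOp κ (p + q) = invOp κ p + invOp κ q := by
  rw [invOp_eq_sum_of_subset κ (support_add (p := p) (q := q)),
    invOp_eq_sum_of_subset κ (Finset.subset_union_left (s₁ := p.support) (s₂ := q.support)),
    invOp_eq_sum_of_subset κ (Finset.subset_union_right (s₁ := p.support) (s₂ := q.support)),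
    ← Finset.sum_add_distrib]
  exact Finset.sum_congr rfl fun α _ => by rw [coeff_add, map_add]

omit [Fintype σ] [DecidableEq σ] in
/-- `I_κ` is homogeneous. [cite: BorceaBranden2009II, §1 Cor. 1.7 ("the linear operator `I_κ`")] -/
theorem invOp_smul (κ : σ →₀ ℕ) (c : ℂ) (p : MvPolynomial σ ℂ) : invOp κ (c • p) = c • invOp κ p := by
  rw [invOp_eq_sum_of_subset κ (support_smul (a := c) (f := p)), invOp, Finset.smul_sum]
  exact Finset.sum_congr rfl fun α _ => by rw [coeff_smul, smul_monomial]

omit [Fintype σ] in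
/-- `I_κ` of a finite sum. [cite: BorceaBranden2009II, §1 Cor. 1.7 ("the linear operator `I_κ`")] -/
theorem invOp_sum (κ : σ →₀ ℕ) {ι : Type*} (s : Finset ι) (p : ι → MvPolynomial σ ℂ) :
    invOp κ (∑ j ∈ s, p j) = ∑ j ∈ s, invOp κ (p j) := by
  classical
  induction s using Finset.induction_on with
  | empty => rw [Finset.sum_empty, Finset.sum_empty, invOp, support_zero, Finset.sum_empty]
  | insert j s hj ih => rw [Finset.sum_insert hj, Finset.sum_insert hj, invOp_add, ih]

omit [Fintype σ] [DecidableEq σ] in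
/-- A permutation fixing `κ` commutes with `κ - ·` on exponents. [cite: BorceaBranden2009II, §1 (proof of
Thm. 1.2: "the partial symmetrization operator commutes with `Φ_κ`")] -/
theorem mapDomain_perm_tsub {κ : σ →₀ ℕ} (π : Equiv.Perm σ) (hκ : ∀ i, κ (π i) = κ i) (β : σ →₀ ℕ) :
    Finsupp.mapDomain (⇑π) (κ - β) = κ - Finsupp.mapDomain (⇑π) β := by
  ext j
  obtain ⟨i, rfl⟩ := π.surjective j
  rw [mapDomain_perm_apply, Finsupp.tsub_apply, Finsupp.tsub_apply, mapDomain_perm_apply, hκ]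

omit [Fintype σ] in
/-- **`I_κ` commutes with the permutations of the variables fixing `κ`**: `I_κ(π(p)) = π(I_κ(p))`.
[cite: BorceaBranden2009II, §1 (proof of Thm. 1.2 / Prop. 1.3: `Φ_κ` commutes with partial symmetrization)] -/
theorem invOp_rename {κ : σ →₀ ℕ} (π : Equiv.Perm σ) (hκ : ∀ i, κ (π i) = κ i) (p : MvPolynomial σ ℂ) :
    invOp κ (rename (⇑π) p) = rename (⇑π) (invOp κ p) := by
  rw [invOp, support_rename_of_injective π.injective, Finset.sum_image fun α _ β _ h =>
    Finsupp.mapDomain_injective π.injective h, invOp, map_sum]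
  refine Finset.sum_congr rfl fun β _ => ?_
  rw [coeff_mapDomain_rename_perm, rename_monomial, mapDomain_perm_tsub π hκ]

/-- **`Sym ∘ I_κ = I_κ ∘ Sym`** for a permutation-invariant `κ`. [cite: BorceaBranden2009II, §1 (proof of
Thm. 1.2: "the partial symmetrization operator commutes with `Φ_κ`")] -/
theorem symmetrization_invOp {κ : σ →₀ ℕ} (hκ : ∀ (π : Equiv.Perm σ) i, κ (π i) = κ i)
    (p : MvPolynomial σ ℂ) : symmetrization (invOp κ p) = invOp κ (symmetrization p) := by
  rw [symmetrization_apply, symmetrization_apply, invOp_smul, invOp_sum]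
  congr 1
  exact Finset.sum_congr rfl fun π _ => (invOp_rename π (hκ π) p).symm

omit [Fintype σ] in
/-- `I_κ(p)` is multi-affine when `κ ≤ (1ⁿ)`. [cite: BorceaBranden2009II, §1 Cor. 1.7 (`κ = (1ⁿ)`:
`I_κ : ℂ_{(1ⁿ)}[z] → ℂ_{(1ⁿ)}[z]`)] -/
theorem isMultiAffine_invOp {κ : σ →₀ ℕ} (hκ : ∀ i, κ i ≤ 1) (p : MvPolynomial σ ℂ) :
    IsMultiAffine (invOp κ p) := fun i =>
  degreeOf_le_iff.2 fun γ hγ => (invOp_fits κ p γ hγ i).trans (hκ i)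

end Linear

/-! ## §2 Theorem 1.2 (b) and Proposition 1.3 (b) for `C = ℂ ∖ 𝔻̄` -/

section Main

/-- **Borcea–Brändén II, Theorem 1.2 (b) for `C = ℂ ∖ 𝔻̄`.** If `f` is multi-affine, `(ℂ ∖ 𝔻̄)`-stable
(no zero `z` with all `|z_i| > 1`) and all variables are active in `f` (`deg_{z_i} f = 1` for all `i`), then
`Sym(f)` is `(ℂ ∖ 𝔻̄)`-stable. Proof: `I_{(1ⁿ)}(f)` is `𝔻`-stable and multi-affine (Cor. 1.7), so is its
symmetrization (Thm. 1.2 (a) for `𝔻`), which is `I_{(1ⁿ)}(Sym f)`; invert again.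
[cite: BorceaBranden2009II, §1 Thm. 1.2 (b)] -/
theorem symmetrization_exteriorDiskStable {f : MvPolynomial σ ℂ} (hact : ∀ i, f.degreeOf i = 1)
    (hs : ∀ z : σ → ℂ, (∀ i, 1 < ‖z i‖) → eval z f ≠ 0) (z : σ → ℂ) (hz : ∀ i, 1 < ‖z i‖) :
    eval z (symmetrization f) ≠ 0 := by
  set κ := degVec f with hκdef
  have hκ1 : ∀ i, κ i = 1 := fun i => by rw [hκdef, degVec_apply, hact i]
  have hf : IsMultiAffine f := fun i => (hact i).le
  have hκperm : ∀ (π : Equiv.Perm σ) i, κ (π i) = κ i := fun π i => by rw [hκ1, hκ1]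
  -- `g = I_κ(f)` is `𝔻`-stable and multi-affine
  have hg : IsDiskStable (invOp κ f) := fun u hu => invOp_diskStable hs u hu
  have hgma : IsMultiAffine (invOp κ f) := isMultiAffine_invOp (fun i => (hκ1 i).le) f
  -- so is `Sym g = I_κ(Sym f)`
  have hSg := hg.symmetrization hgma
  rw [symmetrization_invOp hκperm] at hSg
  -- `Sym f ∈ ℂ_κ[z]`, hence `Sym f = I_κ(I_κ(Sym f))` is `(ℂ ∖ 𝔻̄)`-stable
  have hfits : ∀ α ∈ (symmetrization f).support, α ≤ κ := fun α hα =>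
    Finsupp.le_def.2 fun i => (hκ1 i).symm ▸ (monomial_le_degreeOf i hα).trans (hf.symmetrization i)
  have h := invOp_exteriorDiskStable (invOp_fits κ (symmetrization f)) hSg z hz
  rwa [invOp_invOp hfits] at h

/-- **Borcea–Brändén II, Proposition 1.3 (b) for `C = ℂ ∖ 𝔻̄`.** If `f` is multi-affine, `(ℂ ∖ 𝔻̄)`-stable and
depends on both `z_a` and `z_b` (`deg_{z_a} f = deg_{z_b} f = 1`), then for `0 ≤ θ ≤ 1` the partial
symmetrization `θ f + (1-θ) (a b)(f)` is `(ℂ ∖ 𝔻̄)`-stable. Proof: transport along `I_κ`, `κ = degVec f`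
(invariant under the transposition `(a b)`), to Prop. 1.3 (a) for `𝔻`. [cite: BorceaBranden2009II, §1
Prop. 1.3 (b)] -/
theorem partialSymmetrization_exteriorDiskStable {f : MvPolynomial σ ℂ} (hf : IsMultiAffine f) {a b : σ}
    (ha : f.degreeOf a = 1) (hb : f.degreeOf b = 1)
    (hs : ∀ z : σ → ℂ, (∀ i, 1 < ‖z i‖) → eval z f ≠ 0) {θ : ℝ} (h0 : 0 ≤ θ) (h1 : θ ≤ 1)
    (z : σ → ℂ) (hz : ∀ i, 1 < ‖z i‖) :
    eval z ((θ : ℂ) • f + (1 - (θ : ℂ)) • rename (Equiv.swap a b) f) ≠ 0 := by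
  set κ := degVec f with hκdef
  have hκle : ∀ i, κ i ≤ 1 := fun i => by rw [hκdef, degVec_apply]; exact hf i
  have hκswap : ∀ i, κ (Equiv.swap a b i) = κ i := fun i => by
    have hκa : κ a = 1 := by rw [hκdef, degVec_apply, ha]
    have hκb : κ b = 1 := by rw [hκdef, degVec_apply, hb]
    by_cases hia : i = a
    · rw [hia, Equiv.swap_apply_left, hκa, hκb]
    · by_cases hib : i = b
      · rw [hib, Equiv.swap_apply_right, hκa, hκb]
      · rw [Equiv.swap_apply_of_ne_of_ne hia hib]
  -- `g = I_κ(f)` is `𝔻`-stable and multi-affine; Prop. 1.3 (a) for `𝔻`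
  have hg : IsDiskStable (invOp κ f) := fun u hu => invOp_diskStable hs u hu
  have hgma : IsMultiAffine (invOp κ f) := isMultiAffine_invOp hκle f
  have hG := hg.partialSymmetrization hgma a b h0 h1
  rw [← invOp_rename (Equiv.swap a b) hκswap, ← invOp_smul, ← invOp_smul, ← invOp_add] at hG
  -- the partial symmetrization of `f` lies in `ℂ_κ[z]`
  set F := (θ : ℂ) • f + (1 - (θ : ℂ)) • rename (⇑(Equiv.swap a b)) f with hF
  have hfits : ∀ α ∈ F.support, α ≤ κ := by
    intro α hα
    rcases Finset.mem_union.1 (support_add hα) with h | h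
    · exact le_degVec (mem_support_iff.1 (support_smul h))
    · have h' := support_smul h
      rw [support_rename_of_injective (Equiv.swap a b).injective, Finset.mem_image] at h'
      obtain ⟨β, hβ, rfl⟩ := h'
      refine Finsupp.le_def.2 fun j => ?_
      obtain ⟨i, rfl⟩ := (Equiv.swap a b).surjective j
      rw [mapDomain_perm_apply, hκswap]
      exact Finsupp.le_def.1 (le_degVec (mem_support_iff.1 hβ)) i
  have h := invOp_exteriorDiskStable (invOp_fits κ F) hG z hz
  rwa [invOp_invOp hfits] at h

end Main

end Literature.Combinatorics.StablePolynomials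

end
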